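import Mathlib.Analysis.Calculus.MeanValue
import Mathlib.Analysis.Calculus.Deriv.MeanValue
import Mathlib.Analysis.Calculus.Deriv.Slope
import Mathlib.MeasureTheory.Function.Jacobian
import Mathlib.Topology.Algebra.Module.Determinant
import HarnessLib

/-!
# Rolle's theorem with a perturbed level, and regular values on the line

Topic `Literature/Analysis/Calculus`. One-variable lemmas behind Khovanskii's count of the zeros
of a function along a curve (A. G. Khovanskii, *Fewnomials*, Transl. Math. Monogr. 88 (1991),
Ch. III, "Analogues of the theorems of Rolle and Bezout"; J.-J. Risler, Sém. Bourbaki 637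
(1984–85), §2): if `h' = ψ · p` with `ψ > 0`, then between two zeros `s < s'` of `h`, the first of
which is transversal (`p(s) ≠ 0`), the function `p` takes **every sufficiently small value `δ`**
(not only the value `0` given by Rolle's theorem) — so that the auxiliary level `δ` can later be
chosen to be a regular value of `p`. Everything here is **proved**:

* `exists_forall_exists_eq_of_zeros` — the perturbed Rolle lemma just described;
* `exists_finset_card_le_of_zeros` — for a finite set `S` of transversal zeros of `h` and every
  small `δ` there are at least `#S - 1` points strictly between elements of `S` where `p = δ`;
* `volume_image_setOf_deriv_eq_zero` — the critical values of a differentiable `p : ℝ → ℝ` form a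
  Lebesgue-null set (Sard in dimension one, from Mathlib's fixed-dimension Sard lemma
  `MeasureTheory.addHaar_image_eq_zero_of_det_fderivWithin_eq_zero`);
* `exists_abs_lt_notMem_of_volume_eq_zero`, `exists_mem_Ioo_notMem_of_volume_eq_zero` — a null
  set misses points of every interval.

## References

* A. G. Khovanskii, *Fewnomials*, Transl. Math. Monogr. 88, AMS (1991), Ch. III.
* J.-J. Risler, *Complexité et géométrie réelle (d'après A. Khovansky)*, Sém. Bourbaki 637,
  Astérisque 133–134 (1986), §2.
-/

noncomputable section

open Set Filter MeasureTheory
open scoped Topology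

namespace Literature.Analysis.Calculus

/-! ### Regular values of functions of one variable -/

/-- **Sard's theorem on the line**: the set of critical values of a differentiable function
`p : ℝ → ℝ` is Lebesgue-null. [folklore] -/
theorem volume_image_setOf_deriv_eq_zero {p : ℝ → ℝ} (hp : Differentiable ℝ p) :
    volume (p '' {c | deriv p c = 0}) = 0 := by
  refine addHaar_image_eq_zero_of_det_fderivWithin_eq_zero (μ := volume)
    (f' := fun c => ContinuousLinearMap.toSpanSingleton ℝ (deriv p c)) (fun c _ => ?_)
    (fun c hc => ?_)
  · exact (hasDerivAt_iff_hasFDerivAt.1 (hp c).hasDerivAt).hasFDerivWithinAt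
  · rw [ContinuousLinearMap.det_toSpanSingleton]
    exact hc

/-- A null set misses a point `δ` with `|δ| < ε`. [folklore] -/
theorem exists_abs_lt_notMem_of_volume_eq_zero {N : Set ℝ} (hN : volume N = 0) {ε : ℝ}
    (hε : 0 < ε) : ∃ δ : ℝ, |δ| < ε ∧ δ ∉ N := by
  by_contra hcon
  push Not at hcon
  have hsub : Ioo (-ε) ε ⊆ N := fun δ hδ => hcon δ (abs_lt.2 ⟨hδ.1, hδ.2⟩)
  have h1 : volume (Ioo (-ε) ε) ≤ volume N := measure_mono hsub
  rw [hN, Real.volume_Ioo, nonpos_iff_eq_zero, ENNReal.ofReal_eq_zero] at h1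
  linarith

/-- A null set misses a point of every nonempty open interval. [folklore] -/
theorem exists_mem_Ioo_notMem_of_volume_eq_zero {N : Set ℝ} (hN : volume N = 0) {a b : ℝ}
    (hab : a < b) : ∃ δ ∈ Ioo a b, δ ∉ N := by
  by_contra hcon
  push Not at hcon
  have hsub : Ioo a b ⊆ N := fun δ hδ => hcon δ hδ
  have h1 : volume (Ioo a b) ≤ volume N := measure_mono hsub
  rw [hN, Real.volume_Ioo, nonpos_iff_eq_zero, ENNReal.ofReal_eq_zero] at h1
  linarith

/-! ### Rolle's theorem with a perturbed level -/

/-- A function with positive derivative at `s` is positive immediately to the right of `s` if it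
vanishes at `s`. [folklore] -/
theorem exists_forall_Ioo_pos_of_hasDerivAt {h : ℝ → ℝ} {h' s : ℝ} (hd : HasDerivAt h h' s)
    (hs : h s = 0) (hh' : 0 < h') : ∃ ε₀ > 0, ∀ t ∈ Ioo s (s + ε₀), 0 < h t := by
  have hslope := hasDerivAt_iff_tendsto_slope.1 hd
  have hev : ∀ᶠ t in 𝓝[≠] s, 0 < slope h s t := hslope.eventually (lt_mem_nhds hh')
  rw [eventually_nhdsWithin_iff, Metric.eventually_nhds_iff] at hev
  obtain ⟨ε₀, hε₀, hP⟩ := hev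
  refine ⟨ε₀, hε₀, fun t ht => ?_⟩
  have hts : t ≠ s := ne_of_gt ht.1
  have h1 := hP (y := t) (by rw [Real.dist_eq, abs_lt]; constructor <;> linarith [ht.1, ht.2])
    hts
  rw [slope_def_field, hs, sub_zero] at h1
  exact (div_pos_iff_of_pos_right (sub_pos.2 ht.1)).1 h1

/-- The perturbed Rolle lemma in the case `p(s) > 0`. [folklore] -/
theorem exists_forall_exists_eq_of_zeros_of_pos {h p ψ : ℝ → ℝ} (hψ : ∀ t, 0 < ψ t)
    (hd : ∀ t, HasDerivAt h (ψ t * p t) t) (hp : Continuous p) {s s' : ℝ} (hss' : s < s')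
    (hs : h s = 0) (hs' : h s' = 0) (hps : 0 < p s) :
    ∃ ε > 0, ∀ δ : ℝ, |δ| < ε → ∃ c ∈ Ioo s s', p c = δ := by
  have hcont : Continuous h := continuous_iff_continuousAt.2 fun t => (hd t).continuousAt
  -- `h > 0` immediately to the right of `s`
  obtain ⟨ε₁, hε₁, hpos₁⟩ := exists_forall_Ioo_pos_of_hasDerivAt (hd s) hs (mul_pos (hψ s) hps)
  set ε₀ := min ε₁ (s' - s) with hε₀
  have hε₀pos : 0 < ε₀ := lt_min hε₁ (sub_pos.2 hss')
  have hpos : ∀ t ∈ Ioo s (s + ε₀), 0 < h t := fun t ht =>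
    hpos₁ t ⟨ht.1, ht.2.trans_le (by linarith [min_le_left ε₁ (s' - s)])⟩
  have hε₀le : s + ε₀ ≤ s' := by linarith [min_le_right ε₁ (s' - s)]
  -- the first zero `u` of `h` after `s`
  set A : Set ℝ := Icc (s + ε₀) s' ∩ {t | h t = 0} with hA
  have hAclosed : IsClosed A := isClosed_Icc.inter (isClosed_eq hcont continuous_const)
  have hAne : A.Nonempty := ⟨s', ⟨hε₀le, le_rfl⟩, hs'⟩
  have hAbdd : BddBelow A := ⟨s + ε₀, fun t ht => ht.1.1⟩
  set u := sInf A with hu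
  have huA : u ∈ A := hAclosed.csInf_mem hAne hAbdd
  have hu0 : h u = 0 := huA.2
  have hsu : s < u := by linarith [huA.1.1]
  have hus' : u ≤ s' := huA.1.2
  have hne : ∀ t ∈ Ioo s u, h t ≠ 0 := by
    intro t ht h0
    by_cases hlt : t < s + ε₀
    · exact (hpos t ⟨ht.1, hlt⟩).ne' h0
    · push Not at hlt
      have htA : t ∈ A := ⟨⟨hlt, ht.2.le.trans hus'⟩, h0⟩
      have := csInf_le hAbdd htA
      linarith [ht.2]
  have hposu : ∀ t ∈ Ioo s u, 0 < h t := by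
    intro t ht
    by_contra hle
    push Not at hle
    have hlt : h t < 0 := lt_of_le_of_ne hle (hne t ht)
    -- a point `t' ∈ (s, t)` close to `s` where `h > 0`
    set t' := s + min ε₀ (t - s) / 2 with ht'
    have ht's : s < t' := by
      rw [ht']; linarith [lt_min hε₀pos (sub_pos.2 ht.1)]
    have ht't : t' < t := by
      rw [ht']; linarith [min_le_right ε₀ (t - s), sub_pos.2 ht.1]
    have ht'pos : 0 < h t' := hpos t' ⟨ht's, by
      rw [ht']; linarith [min_le_left ε₀ (t - s), hε₀pos]⟩
    have hivt := intermediate_value_Icc' ht't.le hcont.continuousOn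
    obtain ⟨c, hc, hc0⟩ := hivt ⟨hlt.le, ht'pos.le⟩
    exact hne c ⟨ht's.trans_le hc.1, hc.2.trans_lt ht.2⟩ hc0
  -- mean value theorem on `[s, m]` and `[m, u]`
  set m := (s + u) / 2 with hm
  have hsm : s < m := by rw [hm]; linarith
  have hmu : m < u := by rw [hm]; linarith
  have hm0 : 0 < h m := hposu m ⟨hsm, hmu⟩
  obtain ⟨a, ha, hda⟩ := exists_hasDerivAt_eq_slope h (fun t => ψ t * p t) hsm
    hcont.continuousOn (fun t _ => hd t)
  obtain ⟨b, hb, hdb⟩ := exists_hasDerivAt_eq_slope h (fun t => ψ t * p t) hmu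
    hcont.continuousOn (fun t _ => hd t)
  have hpa : 0 < p a := by
    have h1 : 0 < ψ a * p a := by
      rw [hda, hs, sub_zero]; exact div_pos hm0 (sub_pos.2 hsm)
    exact (mul_pos_iff_of_pos_left (hψ a)).1 h1
  have hpb : p b < 0 := by
    have h1 : ψ b * p b < 0 := by
      rw [hdb, hu0, zero_sub]; exact div_neg_of_neg_of_pos (neg_lt_zero.2 hm0) (sub_pos.2 hmu)
    rcases lt_trichotomy (p b) 0 with hlt | heq | hgt
    · exact hlt
    · rw [heq, mul_zero] at h1; exact (lt_irrefl _ h1).elim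
    · exact absurd h1 (not_lt.2 (mul_pos (hψ b) hgt).le)
  refine ⟨min (p a) (-p b), lt_min hpa (neg_pos.2 hpb), fun δ hδ => ?_⟩
  have hδ1 : δ < p a := (abs_lt.1 hδ).2.trans_le (min_le_left _ _)
  have hδ2 : p b < δ := by
    have := (abs_lt.1 hδ).1; linarith [min_le_right (p a) (-p b)]
  have hmem : δ ∈ uIcc (p a) (p b) := by
    rw [uIcc_comm, uIcc_of_le (hpb.trans hpa).le]
    exact ⟨hδ2.le, hδ1.le⟩
  obtain ⟨c, hc, hpc⟩ := intermediate_value_uIcc hp.continuousOn hmem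
  refine ⟨c, ?_, hpc⟩
  have hau : a ∈ Ioo s u := ⟨ha.1, ha.2.trans hmu⟩
  have hbu : b ∈ Ioo s u := ⟨hsm.trans hb.1, hb.2⟩
  rcases le_total a b with hab | hab
  · rw [uIcc_of_le hab] at hc
    exact ⟨hau.1.trans_le hc.1, (hc.2.trans_lt hbu.2).trans_le hus'⟩
  · rw [uIcc_of_ge hab] at hc
    exact ⟨hbu.1.trans_le hc.1, (hc.2.trans_lt hau.2).trans_le hus'⟩

/-- **Rolle's theorem with a perturbed level.** Let `h' = ψ · p` with `ψ > 0` and `p` continuous,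
and let `s < s'` be zeros of `h` with `p(s) ≠ 0`. Then every sufficiently small `δ` is a value of
`p` on `(s, s')` (for `δ = 0` this is Rolle's theorem; the point is that a whole neighbourhood of
levels is attained, so that `δ` can later be taken to be a regular value of `p`). This is the
one-dimensional core of the "Rolle–Khovanskii" argument (Khovanskii 1991, Ch. III).
[cite: Khovanskii1991, Ch. III] -/
theorem exists_forall_exists_eq_of_zeros {h p ψ : ℝ → ℝ} (hψ : ∀ t, 0 < ψ t)
    (hd : ∀ t, HasDerivAt h (ψ t * p t) t) (hp : Continuous p) {s s' : ℝ} (hss' : s < s')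
    (hs : h s = 0) (hs' : h s' = 0) (hps : p s ≠ 0) :
    ∃ ε > 0, ∀ δ : ℝ, |δ| < ε → ∃ c ∈ Ioo s s', p c = δ := by
  rcases lt_or_gt_of_ne hps with hneg | hpos
  · -- apply the positive case to `-h`, `-p`
    have hd' : ∀ t, HasDerivAt (fun t => -h t) (ψ t * (-p t)) t := fun t => by
      have := (hd t).neg
      rwa [← mul_neg] at this
    obtain ⟨ε, hε, hεP⟩ := exists_forall_exists_eq_of_zeros_of_pos hψ hd' hp.neg hss'
      (by simp [hs]) (by simp [hs']) (neg_pos.2 hneg)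
    refine ⟨ε, hε, fun δ hδ => ?_⟩
    obtain ⟨c, hc, hpc⟩ := hεP (-δ) (by rwa [abs_neg])
    exact ⟨c, hc, neg_injective hpc⟩
  · exact exists_forall_exists_eq_of_zeros_of_pos hψ hd hp hss' hs hs' hpos

/-- **Counting lemma.** With `h' = ψ · p` (`ψ > 0`, `p` continuous), let `S` be a finite set of
zeros of `h` at which `p ≠ 0`. Then for every sufficiently small `δ` there is a finite set `T` of
points lying strictly between elements of `S`, with `p = δ` on `T` and `#S ≤ #T + 1` (one point in
each gap between consecutive elements of `S`). [cite: Khovanskii1991, Ch. III] -/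
theorem exists_finset_card_le_of_zeros {h p ψ : ℝ → ℝ} (hψ : ∀ t, 0 < ψ t)
    (hd : ∀ t, HasDerivAt h (ψ t * p t) t) (hp : Continuous p) (S : Finset ℝ)
    (hS : ∀ s ∈ S, h s = 0 ∧ p s ≠ 0) :
    ∃ ε > 0, ∀ δ : ℝ, |δ| < ε → ∃ T : Finset ℝ, S.card ≤ T.card + 1 ∧
      ∀ c ∈ T, p c = δ ∧ (∃ s ∈ S, s < c) ∧ ∃ s' ∈ S, c < s' := by
  induction S using Finset.induction_on_max with
  | empty => exact ⟨1, one_pos, fun δ _ => ⟨∅, by simp, by simp⟩⟩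
  | insert a S haS ih =>
    obtain ⟨ε, hε, hεP⟩ := ih fun s hs => hS s (Finset.mem_insert_of_mem hs)
    rcases S.eq_empty_or_nonempty with rfl | hne
    · refine ⟨1, one_pos, fun δ _ => ⟨∅, by simp, by simp⟩⟩
    set m := S.max' hne with hm
    have hmS : m ∈ S := S.max'_mem hne
    have hma : m < a := haS m hmS
    obtain ⟨ε', hε', hε'P⟩ := exists_forall_exists_eq_of_zeros hψ hd hp hma
      (hS m (Finset.mem_insert_of_mem hmS)).1 (hS a (Finset.mem_insert_self a S)).1
      (hS m (Finset.mem_insert_of_mem hmS)).2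
    refine ⟨min ε ε', lt_min hε hε', fun δ hδ => ?_⟩
    obtain ⟨T, hT, hTP⟩ := hεP δ (hδ.trans_le (min_le_left _ _))
    obtain ⟨c, hc, hpc⟩ := hε'P δ (hδ.trans_le (min_le_right _ _))
    have hcT : c ∉ T := by
      intro hcT
      obtain ⟨-, -, s', hs', hcs'⟩ := hTP c hcT
      have : s' ≤ m := S.le_max' s' hs'
      linarith [hc.1]
    refine ⟨insert c T, ?_, ?_⟩
    · rw [Finset.card_insert_of_notMem (fun h => haS a h |>.false), Finset.card_insert_of_notMem hcT]
      omega
    · intro x hx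
      rcases Finset.mem_insert.1 hx with rfl | hxT
      · exact ⟨hpc, ⟨m, Finset.mem_insert_of_mem hmS, hc.1⟩, a, Finset.mem_insert_self a S, hc.2⟩
      · obtain ⟨h1, ⟨s, hs, hsc⟩, s', hs', hcs'⟩ := hTP x hxT
        exact ⟨h1, ⟨s, Finset.mem_insert_of_mem hs, hsc⟩, s', Finset.mem_insert_of_mem hs', hcs'⟩

end Literature.Analysis.Calculus
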